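import Literature.MathematicalPhysics.QuantumFieldTheory.Balaban1983to89.T3UnitScaleTilt
import Literature.MathematicalPhysics.QuantumFieldTheory.Balaban1983to89.T3UnitLawDensityEML
import Literature.MathematicalPhysics.QuantumFieldTheory.Balaban1983to89.T4HaarSU2ExpChart
import Literature.MathematicalPhysics.QuantumFieldTheory.Balaban1983to89.T4CubeChartGnomonic
import Literature.MathematicalPhysics.QuantumFieldTheory.Balaban1983to89.B12GaugeOrbits021
import HarnessLib

/-!
# S2β · debt (k3) «PARTNER-PLAQ» — THE PARTNER'S (GAUGED) STAGE FIELDS ARE `PlaqSmall` OF θ-CLASS, read off the station prefix's `histGood` binder: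
# `(e^ζU₀) ∈ histGood F ℰp θ K J ⟹ ∀ t < K − J, PlaqSmall (θ (J + (t+1))) (Ū^{K−(J+(t+1))}(e^ζU₀))`, and the same for every gauge copy `g_s • Ū^s(e^ζU₀)`

Cell `ym3-torus` (YM ladder rung R3 = continuum `SU(2)` Yang–Mills on the three-torus at fixed lattice data — a RUNG: NOT d = 4, NOT infinite volume, NOT a mass gap,
NOT Clay).  Width seat `ym-ust-20520-w4` (gen 28); crux `stmt-QuantumFields-20520` `FluctuationComparisonRegPrIntL` (DECIDING), LINE g18-1 S2β (registry
`Lines/semiclassical_s2beta.lean` UNTOUCHED), the SUP CHAIN's column suppliers.  ARCHITECT px17 g22 22:05:02Z∕22:33:04Z: debt **(k3) PARTNER-PLAQ** — the plaquette class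
of the PARTNER tower's stage fields, needed as the binder `hplaqW` (stage-gauge edition) ∕ `hplaqP` (ungauged edition) of px16 g24 ✓p835991 `…S2BetaKappaRatioTower`
(`hκrel_of_regionLetters` ∕ `hκrel_of_textLetters`) and as `hplaq`-type letters of px20 g24 ✓p835795 `discRow'` ∕ LEAD's knit, with `a′ : ℕ → ℝ` FREE there.  THIS FILE reads
them off the STATION PREFIX (✓p834059 ∕ ✓p835801): `U₀ ∈ histGood F ℰp θ K J` and `(fun ℓ => expPoint (ζ ℓ) * U₀ ℓ) ∈ histGood F ℰp θ K J`, where lit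
✓`T3UnitScaleTilt.histGood F ℰ θ K n = {U | ∀ j, j + n ≤ K → PlaqSmall (θ (K − j)) (Ū^j U)}` ([Balaban1985UV3] (7) p.257, the small-field term at every constrained height):
at the child height `s = K − (J + (t+1))` of step `t < K − J` one has `s + J ≤ K` and `K − s = J + (t+1)`, so **`a′ t := θ (J + (t + 1))`** — nothing else is used.
`--kind proof --supports stmt-QuantumFields-20520 --as helper`, count-neutral, DEFINITION-FREE (0 `def`, 0 `instance`, 0 `notation`, 0 `sorry`, default heartbeats).

WHAT IS PROVED (sorry-free; [folklore] bookkeeping — membership unfolding, `K − (K − (J+(t+1))) = J + (t+1)`, gauge invariance of `PlaqSmall` by lit ✓`B12GaugeOrbits021.plaqSmall_gaugeAct_iff'`).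
§1 ANY `[GaugeGroup G]`, any family `F`, any small-loop average `ℰ`, any `U ∈ histGood F ℰ θ K n`:
   `plaqSmall_iter_of_mem_histGood` (height form: `j + n ≤ K ⟹ PlaqSmall (θ (K − j)) (Ū^j U)`), ★`plaqSmall_stage_of_mem_histGood` (STEP form: `t < K − n ⟹
   PlaqSmall (θ (n + (t+1))) (Ū^{K−(n+(t+1))} U)`), `plaqSmall_stage_of_mem_histGood_of_le` (any `a′` with `θ (n + (t+1)) ≤ a′ t`), ★`plaqSmall_gaugeAct_stage_of_mem_histGood`
   (every gauge copy `u • Ū^{K−(n+(t+1))} U`, same class) and its `_of_le` form.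
§2 THE `SU(2)` PARTNER TOWER OF THE SUP CHAIN (`ℰ := ℰp`, the station's binder texts VERBATIM): ★★`hplaqP_of_histGood` — from
   `(fun ℓ => expPoint (ζ ℓ) * U₀ ℓ) ∈ histGood F ℰp θ K J`: **`∀ t, t < K − J → PlaqSmall (θ (J + (t + 1))) (Averaging.iter (fun k => blockAvg (P := F.P K) (j := k) ℰp) (K − (J + (t + 1)))
   (fun ℓ => expPoint (ζ ℓ) * U₀ ℓ))`** = γ v3's `hplaqP` at `a′ t := θ (J + (t+1))`; ★★`hplaqW_of_histGood` — for ANY gauge family `g : (j : ℕ) → Site (F.P K) j → SU2`: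
   **`∀ t, t < K − J → PlaqSmall (θ (J + (t + 1))) (GaugeField.gaugeAct (g (K − (J + (t + 1)))) (Averaging.iter … (K − (J + (t + 1))) (fun ℓ => expPoint (ζ ℓ) * U₀ ℓ)))`** = γ v3's
   `hplaqW` ∕ the knit's stage-gauge edition; ★`hplaq_of_histGood` ∕ `hplaq_gaugeAct_of_histGood` — the same two for the BACKGROUND tower from `U₀ ∈ histGood F ℰp θ K J` (px20's
   `hplaq : PlaqSmall (a t) (Ū^sU₀)` at `a t := θ (J + (t+1))`, if the consumer prefers the θ-class to (BKG)'s `C_B·α·L^{2s−2(K−J)}` class); and the `_of_le` forms with a free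
   dominating profile `a′` (`θ (J + (t+1)) ≤ a′ t`), so that γ's numeric guard `hthrN` can be met by any admissible majorant.
DOCKING: the conclusions of §2 are the binder texts `hplaqP`∕`hplaqW` (px16 g24 STATUS 22:33:24Z (i)(ii)) with `a' ↦ fun t => θ (J + (t + 1))` — β-reduction only.

HONEST.  Bookkeeping over a lit definition and one lit gauge-invariance lemma; nothing of Bałaban's analysis is asserted or proved ([Balaban1985UV3] (7) p.257 and
[Balaban1987RG1] (0.4), (0.18) are cited as SOURCES of the objects); `histGood` membership of the pair, the gauges `g`, θ, every window∕column∕budget letter, (E5), (ST⁗),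
GAP♯∘ (`stub_uniformFibreGapOrbit`, registry 3732b7df UNTOUCHED, 0∕5), the five REGISTERED stubs, S2β, crux 20520, 19936, 19200, `YM3TorusSU2` — NOT proved; no summit
statement is proved by a helper; rung R3 = SU(2) YM₃ on T³ at fixed lattice data — NOT d = 4, NOT infinite volume, NOT a mass gap, NOT Clay; the Yang–Mills mass gap is NOT
proved.  Axioms standard.

References: [Balaban1985UV3] T. Bałaban, CMP **102** (1985) 255–275, (7) p.257; [Balaban1987RG1] CMP **109** (1987) 249–301, (0.4) p.253, (0.18) p.255.
-/

set_option autoImplicit false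

noncomputable section

namespace Summit.QuantumFields.YangMills.Theorems.FluctuationComparisonRegPrIntLS2BetaPartnerStagePlaqSmall

open Literature.MathematicalPhysics.QuantumFieldTheory.Balaban1983to89
open Literature.MathematicalPhysics.QuantumFieldTheory.Balaban1983to89.T3ContinuumYM3Torus (T3Family)
open Literature.MathematicalPhysics.QuantumFieldTheory.Balaban1983to89.T3UnitScaleTilt (histGood)
open Literature.MathematicalPhysics.QuantumFieldTheory.Balaban1983to89.T3UnitLawDensityEML (ℰp)
open Literature.MathematicalPhysics.QuantumFieldTheory.Balaban1983to89.T4HaarSU2ExpChart (expPoint)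
open Literature.MathematicalPhysics.QuantumFieldTheory.Balaban1983to89.T4CubeChartGnomonic (SU2)
open Literature.MathematicalPhysics.QuantumFieldTheory.Balaban1983to89.BlockAveraging (blockAvg)
open Literature.MathematicalPhysics.QuantumFieldTheory.Balaban1983to89.B12GaugeOrbits021 (plaqSmall_gaugeAct_iff')

/-! ## §1 Any gauge group: the stage fields of a `histGood` field are `PlaqSmall` of θ-class, also after any gauge transformation -/

section Generic

variable {G : Type*} [GaugeGroup G] (F : T3Family) (ℰ : LoopAverage G) (θ : ℕ → ℝ) (K n : ℕ)

/-- HEIGHT FORM (the definition of lit `histGood`, unfolded): `U ∈ histGood F ℰ θ K n`, `j + n ≤ K` ⟹ `PlaqSmall (θ (K − j)) (Ū^j U)`. [cite: Balaban1985UV3, (7) p.257] -/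
theorem plaqSmall_iter_of_mem_histGood {U : GaugeField (F.P K) 0 G} (hU : U ∈ histGood F ℰ θ K n) (j : ℕ) (hj : j + n ≤ K) :
    PlaqSmall (θ (K - j)) (Averaging.iter (fun k => blockAvg (P := F.P K) (j := k) ℰ) j U) :=
  hU j hj

/-- ★ STEP FORM: `U ∈ histGood F ℰ θ K n`, `t < K − n` ⟹ at the child height `s = K − (n + (t+1))` (`s + n ≤ K`, `K − s = n + (t+1)`):
`PlaqSmall (θ (n + (t + 1))) (Ū^{K − (n + (t+1))} U)`. [cite: Balaban1985UV3, (7) p.257] -/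
theorem plaqSmall_stage_of_mem_histGood {U : GaugeField (F.P K) 0 G} (hU : U ∈ histGood F ℰ θ K n) (t : ℕ) (ht : t < K - n) :
    PlaqSmall (θ (n + (t + 1))) (Averaging.iter (fun k => blockAvg (P := F.P K) (j := k) ℰ) (K - (n + (t + 1))) U) := by
  have h : PlaqSmall (θ (K - (K - (n + (t + 1))))) (Averaging.iter (fun k => blockAvg (P := F.P K) (j := k) ℰ) (K - (n + (t + 1))) U) :=
    hU (K - (n + (t + 1))) (by omega)
  have e : K - (K - (n + (t + 1))) = n + (t + 1) := by omega
  rw [e] at h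
  exact h

/-- STEP FORM WITH A FREE MAJORANT: any `a′` with `θ (n + (t+1)) ≤ a′ t` on `t < K − n` is an admissible class. [cite: Balaban1985UV3, (7) p.257] -/
theorem plaqSmall_stage_of_mem_histGood_of_le {U : GaugeField (F.P K) 0 G} (hU : U ∈ histGood F ℰ θ K n) (a' : ℕ → ℝ)
    (ha' : ∀ t, t < K - n → θ (n + (t + 1)) ≤ a' t) (t : ℕ) (ht : t < K - n) :
    PlaqSmall (a' t) (Averaging.iter (fun k => blockAvg (P := F.P K) (j := k) ℰ) (K - (n + (t + 1))) U) :=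
  fun p => (plaqSmall_stage_of_mem_histGood F ℰ θ K n hU t ht p).trans_le (ha' t ht)

/-- ★ GAUGED STEP FORM: for every gauge transformation `u` of the child lattice, `PlaqSmall (θ (n + (t + 1))) (u • Ū^{K − (n + (t+1))} U)` (plaquette variables are
conjugated; lit ✓`plaqSmall_gaugeAct_iff'`). [cite: Balaban1985UV3, (7) p.257; Balaban1987RG1, (0.18) p.255] -/
theorem plaqSmall_gaugeAct_stage_of_mem_histGood {U : GaugeField (F.P K) 0 G} (hU : U ∈ histGood F ℰ θ K n) (t : ℕ) (ht : t < K - n)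
    (u : GaugeTransf (F.P K) (K - (n + (t + 1))) G) :
    PlaqSmall (θ (n + (t + 1))) (GaugeField.gaugeAct u (Averaging.iter (fun k => blockAvg (P := F.P K) (j := k) ℰ) (K - (n + (t + 1))) U)) :=
  (plaqSmall_gaugeAct_iff' _ u _).2 (plaqSmall_stage_of_mem_histGood F ℰ θ K n hU t ht)

/-- GAUGED STEP FORM WITH A FREE MAJORANT. [cite: Balaban1985UV3, (7) p.257; Balaban1987RG1, (0.18) p.255] -/
theorem plaqSmall_gaugeAct_stage_of_mem_histGood_of_le {U : GaugeField (F.P K) 0 G} (hU : U ∈ histGood F ℰ θ K n) (a' : ℕ → ℝ)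
    (ha' : ∀ t, t < K - n → θ (n + (t + 1)) ≤ a' t) (t : ℕ) (ht : t < K - n) (u : GaugeTransf (F.P K) (K - (n + (t + 1))) G) :
    PlaqSmall (a' t) (GaugeField.gaugeAct u (Averaging.iter (fun k => blockAvg (P := F.P K) (j := k) ℰ) (K - (n + (t + 1))) U)) :=
  (plaqSmall_gaugeAct_iff' _ u _).2 (plaqSmall_stage_of_mem_histGood_of_le F ℰ θ K n hU a' ha' t ht)

end Generic

/-! ## §2 The `SU(2)` partner tower of the sup chain: γ v3's `hplaqP` ∕ `hplaqW` and px20's `hplaq` read off the station prefix -/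

section Partner

variable {F : T3Family} {J K : ℕ} (θ : ℕ → ℝ)

/-- ★★ **`hplaqP` FROM THE STATION PREFIX (ungauged edition, γ v3 §3 `hκrel_of_textLetters`)**: if the partner field `e^ζU₀` lies in `histGood F ℰp θ K J`, then for every
step `t < K − J` its stage field at the child height is `PlaqSmall` of class `a′ t := θ (J + (t+1))`:
`PlaqSmall (θ (J + (t + 1))) (Ū^{K − (J + (t+1))}(e^ζU₀))` — the binder text with `a' ↦ fun t => θ (J + (t + 1))`. [cite: Balaban1985UV3, (7) p.257; Balaban1987RG1, (0.4) p.253] -/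
theorem hplaqP_of_histGood (U₀ : GaugeField (F.P K) 0 (Matrix.specialUnitaryGroup (Fin 2) ℂ)) (ζ : PBond (F.P K) 0 → EuclideanSpace ℝ (Fin 3))
    (hζ : (fun ℓ => expPoint (ζ ℓ) * U₀ ℓ : GaugeField (F.P K) 0 (Matrix.specialUnitaryGroup (Fin 2) ℂ)) ∈ histGood F ℰp θ K J) :
    ∀ t, t < K - J → PlaqSmall (θ (J + (t + 1)))
      (Averaging.iter (fun k => blockAvg (P := F.P K) (j := k) ℰp) (K - (J + (t + 1))) (fun ℓ => expPoint (ζ ℓ) * U₀ ℓ)) :=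
  fun t ht => plaqSmall_stage_of_mem_histGood F ℰp θ K J hζ t ht

/-- `hplaqP` with a free majorant `a′` (`θ (J + (t+1)) ≤ a′ t` on `t < K − J`). [cite: Balaban1985UV3, (7) p.257; Balaban1987RG1, (0.4) p.253] -/
theorem hplaqP_of_histGood_of_le (U₀ : GaugeField (F.P K) 0 (Matrix.specialUnitaryGroup (Fin 2) ℂ)) (ζ : PBond (F.P K) 0 → EuclideanSpace ℝ (Fin 3))
    (hζ : (fun ℓ => expPoint (ζ ℓ) * U₀ ℓ : GaugeField (F.P K) 0 (Matrix.specialUnitaryGroup (Fin 2) ℂ)) ∈ histGood F ℰp θ K J)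
    (a' : ℕ → ℝ) (ha' : ∀ t, t < K - J → θ (J + (t + 1)) ≤ a' t) :
    ∀ t, t < K - J → PlaqSmall (a' t)
      (Averaging.iter (fun k => blockAvg (P := F.P K) (j := k) ℰp) (K - (J + (t + 1))) (fun ℓ => expPoint (ζ ℓ) * U₀ ℓ)) :=
  fun t ht => plaqSmall_stage_of_mem_histGood_of_le F ℰp θ K J hζ a' ha' t ht

/-- ★★ **`hplaqW` FROM THE STATION PREFIX (stage-gauge edition, γ v3 §1 `hκrel_of_regionLetters` ∕ the knit)**: for ANY gauge family `g`, the gauged partner stage field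
`g_s • Ū^s(e^ζU₀)`, `s = K − (J + (t+1))`, is `PlaqSmall (θ (J + (t + 1)))` for every `t < K − J`. [cite: Balaban1985UV3, (7) p.257; Balaban1987RG1, (0.4) p.253, (0.18) p.255] -/
theorem hplaqW_of_histGood (U₀ : GaugeField (F.P K) 0 (Matrix.specialUnitaryGroup (Fin 2) ℂ)) (ζ : PBond (F.P K) 0 → EuclideanSpace ℝ (Fin 3))
    (g : (j : ℕ) → Site (F.P K) j → SU2)
    (hζ : (fun ℓ => expPoint (ζ ℓ) * U₀ ℓ : GaugeField (F.P K) 0 (Matrix.specialUnitaryGroup (Fin 2) ℂ)) ∈ histGood F ℰp θ K J) :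
    ∀ t, t < K - J → PlaqSmall (θ (J + (t + 1)))
      (GaugeField.gaugeAct (g (K - (J + (t + 1)))) (Averaging.iter (fun k => blockAvg (P := F.P K) (j := k) ℰp) (K - (J + (t + 1))) (fun ℓ => expPoint (ζ ℓ) * U₀ ℓ))) :=
  fun t ht => plaqSmall_gaugeAct_stage_of_mem_histGood F ℰp θ K J hζ t ht (g (K - (J + (t + 1))))

/-- `hplaqW` with a free majorant `a′`. [cite: Balaban1985UV3, (7) p.257; Balaban1987RG1, (0.4) p.253, (0.18) p.255] -/
theorem hplaqW_of_histGood_of_le (U₀ : GaugeField (F.P K) 0 (Matrix.specialUnitaryGroup (Fin 2) ℂ)) (ζ : PBond (F.P K) 0 → EuclideanSpace ℝ (Fin 3))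
    (g : (j : ℕ) → Site (F.P K) j → SU2)
    (hζ : (fun ℓ => expPoint (ζ ℓ) * U₀ ℓ : GaugeField (F.P K) 0 (Matrix.specialUnitaryGroup (Fin 2) ℂ)) ∈ histGood F ℰp θ K J)
    (a' : ℕ → ℝ) (ha' : ∀ t, t < K - J → θ (J + (t + 1)) ≤ a' t) :
    ∀ t, t < K - J → PlaqSmall (a' t)
      (GaugeField.gaugeAct (g (K - (J + (t + 1)))) (Averaging.iter (fun k => blockAvg (P := F.P K) (j := k) ℰp) (K - (J + (t + 1))) (fun ℓ => expPoint (ζ ℓ) * U₀ ℓ))) :=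
  fun t ht => plaqSmall_gaugeAct_stage_of_mem_histGood_of_le F ℰp θ K J hζ a' ha' t ht (g (K - (J + (t + 1))))

/-- ★ **THE BACKGROUND TOWER, θ-CLASS (px20's `hplaq` shape at `a t := θ (J + (t+1))`)**: `U₀ ∈ histGood F ℰp θ K J` ⟹
`∀ t < K − J, PlaqSmall (θ (J + (t + 1))) (Ū^{K − (J + (t+1))} U₀)`. [cite: Balaban1985UV3, (7) p.257; Balaban1987RG1, (0.4) p.253] -/
theorem hplaq_of_histGood (U₀ : GaugeField (F.P K) 0 (Matrix.specialUnitaryGroup (Fin 2) ℂ)) (hU₀ : U₀ ∈ histGood F ℰp θ K J) :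
    ∀ t, t < K - J → PlaqSmall (θ (J + (t + 1))) (Averaging.iter (fun k => blockAvg (P := F.P K) (j := k) ℰp) (K - (J + (t + 1))) U₀) :=
  fun t ht => plaqSmall_stage_of_mem_histGood F ℰp θ K J hU₀ t ht

/-- The background tower with a free majorant `a` (`θ (J + (t+1)) ≤ a t`) — px20's `hplaq : ∀ t < K − J, PlaqSmall (a t) (Ū^sU₀)` text. [cite: Balaban1985UV3, (7) p.257; Balaban1987RG1, (0.4) p.253] -/
theorem hplaq_of_histGood_of_le (U₀ : GaugeField (F.P K) 0 (Matrix.specialUnitaryGroup (Fin 2) ℂ)) (hU₀ : U₀ ∈ histGood F ℰp θ K J)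
    (a : ℕ → ℝ) (ha : ∀ t, t < K - J → θ (J + (t + 1)) ≤ a t) :
    ∀ t, t < K - J → PlaqSmall (a t) (Averaging.iter (fun k => blockAvg (P := F.P K) (j := k) ℰp) (K - (J + (t + 1))) U₀) :=
  fun t ht => plaqSmall_stage_of_mem_histGood_of_le F ℰp θ K J hU₀ a ha t ht

/-- ★ The gauged background tower (`hplaq₁`-type letters for `g₀_s • Ū^s U₀`, any gauge family `g₀`). [cite: Balaban1985UV3, (7) p.257; Balaban1987RG1, (0.4) p.253, (0.18) p.255] -/
theorem hplaq_gaugeAct_of_histGood (U₀ : GaugeField (F.P K) 0 (Matrix.specialUnitaryGroup (Fin 2) ℂ)) (g₀ : (j : ℕ) → Site (F.P K) j → SU2)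
    (hU₀ : U₀ ∈ histGood F ℰp θ K J) :
    ∀ t, t < K - J → PlaqSmall (θ (J + (t + 1)))
      (GaugeField.gaugeAct (g₀ (K - (J + (t + 1)))) (Averaging.iter (fun k => blockAvg (P := F.P K) (j := k) ℰp) (K - (J + (t + 1))) U₀)) :=
  fun t ht => plaqSmall_gaugeAct_stage_of_mem_histGood F ℰp θ K J hU₀ t ht (g₀ (K - (J + (t + 1))))

end Partner

end Summit.QuantumFields.YangMills.Theorems.FluctuationComparisonRegPrIntLS2BetaPartnerStagePlaqSmall

end
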